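import Literature.Computability.AlgebraicComplexity.BI17FundamentalInvariantForms
import Literature.Computability.AlgebraicComplexity.BI17ChowPowerSumPolystableProofs
import Literature.Computability.AlgebraicComplexity.OrbitCoordinateRing
import Mathlib.LinearAlgebra.QuadraticForm.AlgClosed
import Mathlib.LinearAlgebra.Matrix.SesquilinearForm
import Mathlib.Algebra.MvPolynomial.Funext
import HarnessLib

/-!
# Nondegenerate quadratic forms are polystable — the `D = 2` case of Bürgisser–Ikenmeyer 2017,
# Prop. 2.10 (discharge of a slice of a named fact)

Sibling proof file of `Literature/Computability/AlgebraicComplexity/BI17FundamentalInvariantForms.lean`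
(cell `val-lit`, DAG row BI2017-A), proving the **`D = 2` slice** of its named fact
`Literature.Computability.AlgebraicComplexity.BI2017_prop_2_10` (P. Bürgisser, C. Ikenmeyer,
*Fundamental invariants of orbit closures*, J. Algebra 477 (2017) 390–434 = arXiv:1511.02927,
**Prop. 2.10**, TeX L633–640, held text `paper:arxiv-1511.02927` p0007.txt:L60: "If `D > 1`, then
almost all `w ∈ Sym^D ℂ^m` are polystable. Proof. Theorem 2.3 [generic finite stabilizer] implies
… closed by [Luna 1973, Cor. 1]. (In the exceptional case `D = 2` of quadratic forms, all
`SL_m`-orbits in `Sym²ℂ^m` are closed.)").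

HONEST PARTIAL. Only the printed parenthesis — the quadratic case — is proved here:

* `isPolystable_of_det_quadHessian_ne_zero` — every NONDEGENERATE quadratic form `f ∈ Sym² ℂ^m`
  (Hessian discriminant `det H_f ≠ 0`) is polystable, i.e. its `SL_m`-orbit under linear
  substitution is Zariski closed in coefficient space (tree `IsPolystable`);
* `BI2017_prop_2_10_two : ∀ m, IsZariskiGeneric 2 (IsPolystable : MvPolynomial (Fin m) ℂ → Prop)` —
  "almost all quadratic forms are polystable" in the tree's `IsZariskiGeneric` rendering, the test
  polynomial being the discriminant (nonzero: `2^m` at `X_1² + ⋯ + X_m²`);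
* `BI2017_prop_2_10_of_two_lt` — bookkeeping: the named fact FOLLOWS from its own `D > 2` part, which
  is NOT proved here (printed proof: Thm. 2.3, in the tree as `BI2017_thm_2_3_open_holds`, plus Luna's
  étale slice theorem / criterion [Lun73], absent from Mathlib and the tree — sized XL by the cell).

Print-side nuance (recorded at the corpus lead's request, not an erratum of substance): the
parenthesis "all `SL_m`-orbits in `Sym²ℂ^m` are closed" is true exactly for the NONDEGENERATE
quadrics — a degenerate nonzero quadric such as `X_1²` degenerates to `0` under
`diag(t, t⁻¹, 1, …, 1) ∈ SL_m`, `t → 0`, so its `SL_m`-orbit is not closed; "almost all" is what the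
proposition asserts and what is proved here.

## Proof

Not the printed one-liner (which presupposes the classification of `SL_m`-orbits of quadrics) but:
(1) **polystability is a property of `GL`-orbits** (`IsPolystable.glAct`, any field, any
polynomial: the action of `g ∈ GL` on the big coefficient space `(σ →₀ ℕ) → k` is given degree by
degree by finite matrices with polynomial (linear) coordinates, it commutes with `coeffVec`,
pulls polynomial functions back to polynomial functions, and conjugation by `g` preserves `SL`;
so `g` maps the Zariski closure of `coeffVec '' SL·f` onto that of `coeffVec '' SL·(g·f)`);
(2) the tree's theorem that `X_1² + ⋯ + X_m²` is polystable (`isPolystable_sum_X_pow`, Kempf–Ness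
route of `PolystabilityProofs.lean`, BI 2017 Cor. 2.9); (3) every nondegenerate quadratic form is
`GL_m`-equivalent to `X_1² + ⋯ + X_m²`: over `ℂ` a symmetric matrix with nonzero determinant is
`E Eᵀ` with `det E ≠ 0` (Mathlib's `QuadraticForm.equivalent_of_isAlgClosed`, transported to
matrices by `QuadraticForm.toMatrix'_comp`), and `A · (xᵀ S x) = xᵀ (A S Aᵀ) x` for the
substitution action (`linSubst_quadPoly`), so `f = ½ xᵀ H_f x = (a E) · (X_1² + ⋯ + X_m²)` with
`a² = ½`.

The `Sym² ↔ symmetric-matrix` dictionary (`quadPoly`, `quadHessian`, `quadHessianPoly` and their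
lemmas) is a private re-derivation of the one in `BI17QuadraticPeriodProofs.lean` (same statements,
same proofs; private there, hence not importable). Everything is PROVED; no named facts, no
`instance`, no `notation`; the only `def`s are the three private plumbing definitions just named
and the private coefficient-space action `coeffAct`.

Honest framing: bookkeeping of a published invariant-theory remark inside the BIP literature
programme; nothing here bears on lower bounds or on `VP` versus `VNP`.

## References

* [BurgisserIkenmeyer2017] P. Bürgisser, C. Ikenmeyer, J. Algebra 477 (2017) = arXiv:1511.02927,
  Prop. 2.10 (TeX L633–640; held p0007.txt:L60), Def. 2.7 (polystable), Cor. 2.9.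
* D. Luna, *Slices étales*, Bull. Soc. Math. France Mém. 33 (1973) 81–105 (the `D > 2` input, not
  used here).
-/

noncomputable section

open MvPolynomial Matrix

namespace Literature.Computability.AlgebraicComplexity

/-! ### §1 Polystability is a property of `GL`-orbits -/

section GLInvariance

variable {σ k : Type*} [Fintype σ] [DecidableEq σ] [Field k]

/-- Expansion of the substitution action in the monomial basis, degree by degree: for ANY
polynomial `p` and monomial `d`, `coeff d (g · p) = ∑_{|e| = |d|} coeff d (g · X^e) · coeff e p`
(the action preserves the grading, `coeff_linSubstRep_eq_coeff_homogeneousComponent`, and on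
`Sym^{|d|}` it is the finite matrix `(coeff d (g · X^e))_{d,e}`, `coeff_linSubstRep_eq_sum`).
[cite: BurgisserIkenmeyer2017, Def. 2.7] -/
theorem coeff_linSubstRep_eq_sum_degMonomials (g : GL σ k) (p : MvPolynomial σ k) (d : σ →₀ ℕ) :
    coeff d (linSubstRep σ k g p) =
      ∑ e ∈ degMonomials σ d.degree, coeff d (linSubstRep σ k g (monomial e 1)) * coeff e p := by
  rw [coeff_linSubstRep_eq_coeff_homogeneousComponent g p d]
  have hd : d ∈ degMonomials σ d.degree := mem_degMonomials_iff.mpr rfl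
  have h := coeff_linSubstRep_eq_sum g (homogeneousComponent_isHomogeneous d.degree p) ⟨d, hd⟩
  rw [h, ← Finset.sum_coe_sort (degMonomials σ d.degree)]
  refine Finset.sum_congr rfl fun e _ => ?_
  rw [coeff_homogeneousComponent, if_pos (mem_degMonomials_iff.mp e.2), mul_comm]

/-- The action of `g ∈ GL σ k` on the big coefficient space `(σ →₀ ℕ) → k` (ALL monomials),
degree block by degree block: `(g · y)_d = ∑_{|e| = |d|} coeff d (g · X^e) · y_e`. Private
plumbing for `IsPolystable.glAct`. [cite: BurgisserIkenmeyer2017, Def. 2.7] -/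
private def coeffAct (g : GL σ k) (y : (σ →₀ ℕ) → k) : (σ →₀ ℕ) → k :=
  fun d => ∑ e ∈ degMonomials σ d.degree, coeff d (linSubstRep σ k g (monomial e 1)) * y e

/-- `coeffAct` extends the action on polynomials: `g · coeffVec p = coeffVec (g · p)`.
[cite: BurgisserIkenmeyer2017, Def. 2.7] -/
private theorem coeffAct_coeffVec (g : GL σ k) (p : MvPolynomial σ k) :
    coeffAct g (coeffVec p) = coeffVec (linSubstRep σ k g p) := by
  funext d
  simp only [coeffAct, coeffVec_apply]
  exact (coeff_linSubstRep_eq_sum_degMonomials g p d).symm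

/-- Polynomial functions pull back to polynomial functions under `coeffAct`: `F (g · y) = F'(y)`
with `F'` obtained by substituting for `X_d` the linear form `∑_{|e| = |d|} coeff d (g · X^e) X_e`.
[cite: BurgisserIkenmeyer2017, Def. 2.7] -/
private theorem aeval_coeffAct (g : GL σ k) (y : (σ →₀ ℕ) → k) (F : MvPolynomial (σ →₀ ℕ) k) :
    aeval (coeffAct g y) F =
      aeval y (aeval (fun d : σ →₀ ℕ => ∑ e ∈ degMonomials σ d.degree,
        coeff d (linSubstRep σ k g (monomial e 1)) • (X e : MvPolynomial (σ →₀ ℕ) k)) F) := by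
  have hcomp : (aeval y).comp (aeval (fun d : σ →₀ ℕ => ∑ e ∈ degMonomials σ d.degree,
        coeff d (linSubstRep σ k g (monomial e 1)) • (X e : MvPolynomial (σ →₀ ℕ) k))) =
      aeval (coeffAct g y) := by
    rw [MvPolynomial.comp_aeval]
    refine congrArg _ (funext fun d => ?_)
    simp only [map_sum, map_smul, aeval_X, smul_eq_mul]
    rfl
  rw [← hcomp, AlgHom.comp_apply]

/-- `coeffAct` is multiplicative: `g · (h · y) = (g h) · y`. [cite: BurgisserIkenmeyer2017, Def. 2.7] -/
private theorem coeffAct_mul (g h : GL σ k) (y : (σ →₀ ℕ) → k) :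
    coeffAct g (coeffAct h y) = coeffAct (g * h) y := by
  funext d
  simp only [coeffAct]
  have hinner : ∀ e ∈ degMonomials σ d.degree,
      coeff d (linSubstRep σ k g (monomial e 1)) *
          (∑ e' ∈ degMonomials σ e.degree, coeff e (linSubstRep σ k h (monomial e' 1)) * y e') =
        ∑ e' ∈ degMonomials σ d.degree,
          coeff d (linSubstRep σ k g (monomial e 1)) *
            (coeff e (linSubstRep σ k h (monomial e' 1)) * y e') := by
    intro e he
    rw [mem_degMonomials_iff.mp he, Finset.mul_sum]
  rw [Finset.sum_congr rfl hinner, Finset.sum_comm]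
  refine Finset.sum_congr rfl fun e' _ => ?_
  rw [map_mul, Module.End.mul_apply, coeff_linSubstRep_eq_sum_degMonomials g, Finset.sum_mul]
  refine Finset.sum_congr rfl fun e _ => ?_
  ring

/-- The identity acts as the identity on the big coefficient space. [cite: BurgisserIkenmeyer2017, Def. 2.7] -/
private theorem coeffAct_one (y : (σ →₀ ℕ) → k) : coeffAct (1 : GL σ k) y = y := by
  funext d
  simp only [coeffAct, map_one, Module.End.one_apply, coeff_monomial, ite_mul, one_mul, zero_mul]
  rw [Finset.sum_ite_eq' (degMonomials σ d.degree) d (fun e => y e),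
    if_pos (mem_degMonomials_iff.mpr rfl)]

/-- Conjugation by `g ∈ GL` preserves `SL`: the `SL`-orbit of `g · f` is `g · (SL · f)`.
[cite: BurgisserIkenmeyer2017, Def. 2.7] -/
theorem slOrbit_linSubstRep (g : GL σ k) (f : MvPolynomial σ k) :
    slOrbit σ k (linSubstRep σ k g f) = (linSubstRep σ k g) '' slOrbit σ k f := by
  have hdet : ∀ s : Matrix.SpecialLinearGroup σ k,
      (((g⁻¹ : GL σ k) : Matrix σ σ k) * (s : Matrix σ σ k) * (g : Matrix σ σ k)).det = 1 ∧
      (((g : GL σ k) : Matrix σ σ k) * (s : Matrix σ σ k) * ((g⁻¹ : GL σ k) : Matrix σ σ k)).det = 1 := by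
    intro s
    have h1 : ((g⁻¹ : GL σ k) : Matrix σ σ k).det * (g : Matrix σ σ k).det = 1 := by
      rw [← det_mul, ← Units.val_mul, inv_mul_cancel, Units.val_one, det_one]
    have h2 : ((g : GL σ k) : Matrix σ σ k).det * ((g⁻¹ : GL σ k) : Matrix σ σ k).det = 1 := by
      rw [mul_comm, h1]
    refine ⟨?_, ?_⟩
    · rw [det_mul, det_mul, s.prop, mul_one, h1]
    · rw [det_mul, det_mul, s.prop, mul_one, h2]
  ext p
  constructor
  · rintro ⟨s, rfl⟩
    refine ⟨linSubst σ k (((g⁻¹ : GL σ k) : Matrix σ σ k) * (s : Matrix σ σ k) * (g : Matrix σ σ k)) f,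
      ⟨⟨_, (hdet s).1⟩, rfl⟩, ?_⟩
    rw [linSubstRep_apply, linSubstRep_apply, ← AlgHom.comp_apply, ← linSubst_mul,
      ← AlgHom.comp_apply, ← linSubst_mul, ← Matrix.mul_assoc, ← Matrix.mul_assoc,
      ← Units.val_mul, mul_inv_cancel, Units.val_one, Matrix.one_mul]
  · rintro ⟨q, ⟨s, rfl⟩, rfl⟩
    refine ⟨⟨_, (hdet s).2⟩, ?_⟩
    change linSubst σ k (g : Matrix σ σ k) (linSubst σ k (s : Matrix σ σ k) f) =
      linSubst σ k (((g : GL σ k) : Matrix σ σ k) * (s : Matrix σ σ k) * ((g⁻¹ : GL σ k) : Matrix σ σ k))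
        (linSubst σ k (g : Matrix σ σ k) f)
    rw [← AlgHom.comp_apply, ← linSubst_mul, ← AlgHom.comp_apply, ← linSubst_mul, Matrix.mul_assoc,
      ← Units.val_mul, inv_mul_cancel, Units.val_one, Matrix.mul_one]

/-- **Polystability is a property of `GL`-orbits**: if the `SL`-orbit of `f` is Zariski closed in
coefficient space, so is the `SL`-orbit of `g · f` for every `g ∈ GL σ k` (any field, any
polynomial). The closure point `y` of `coeffVec '' SL·(g·f)` is moved by `g⁻¹` (acting on the big
coefficient space through `coeffAct`, which pulls polynomial functions back to polynomial
functions) to a closure point of `coeffVec '' SL·f = g⁻¹ · (coeffVec '' SL·(g·f))`, which lies in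
the orbit by hypothesis; moving back by `g` lands in `SL·(g·f)`.
[cite: BurgisserIkenmeyer2017, Def. 2.7] -/
theorem IsPolystable.glAct {f : MvPolynomial σ k} (hf : IsPolystable f) (g : GL σ k) :
    IsPolystable (linSubstRep σ k g f) := by
  intro y hy
  -- `g⁻¹ · y` is a closure point of `coeffVec '' SL·f`
  have h1 : coeffAct g⁻¹ y ∈ zariskiClosure (coeffVec '' slOrbit σ k f) := by
    rw [mem_zariskiClosure_iff]
    intro F hF
    rw [aeval_coeffAct]
    apply mem_zariskiClosure_iff.mp hy
    rintro _ ⟨q, hq, rfl⟩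
    rw [← aeval_coeffAct, coeffAct_coeffVec]
    apply hF
    refine ⟨linSubstRep σ k g⁻¹ q, ?_, rfl⟩
    rw [slOrbit_linSubstRep] at hq
    obtain ⟨q₀, hq₀, rfl⟩ := hq
    rwa [← Module.End.mul_apply, ← map_mul, inv_mul_cancel, map_one, Module.End.one_apply]
  -- hence an orbit point, and `y = g · (g⁻¹ · y)` lies in `SL·(g·f)`
  obtain ⟨q₀, hq₀, hq₀y⟩ := hf h1
  refine ⟨linSubstRep σ k g q₀, ?_, ?_⟩
  · rw [slOrbit_linSubstRep]
    exact ⟨q₀, hq₀, rfl⟩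
  · rw [← coeffAct_coeffVec, hq₀y, coeffAct_mul, mul_inv_cancel, coeffAct_one]

/-- Matrix form of `IsPolystable.glAct`: `A · f` is polystable for every matrix `A` with
`det A ≠ 0` when `f` is. [cite: BurgisserIkenmeyer2017, Def. 2.7] -/
theorem IsPolystable.linSubst_of_det_ne_zero {f : MvPolynomial σ k} (hf : IsPolystable f)
    {A : Matrix σ σ k} (hA : A.det ≠ 0) : IsPolystable (linSubst σ k A f) := by
  have h := hf.glAct (Matrix.GeneralLinearGroup.mkOfDetNeZero A hA)
  rwa [linSubstRep_apply] at h

end GLInvariance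

/-! ### §2 Quadratic forms and symmetric matrices (private dictionary, as in
`BI17QuadraticPeriodProofs.lean`) -/

section Quadratic

variable {m : ℕ}

/-- A monomial exponent of degree `1` is a single variable (private copy, as in the sibling proof
files, of the tree's `Finsupp.exists_eq_single_of_degree_eq_one`). [folklore] -/
private theorem exists_eq_single_of_degree_eq_one' {d : Fin m →₀ ℕ} (hd : d.degree = 1) :
    ∃ i, d = Finsupp.single i 1 := by
  classical
  have hne : d ≠ 0 := by
    rintro rfl
    simp at hd
  obtain ⟨i, hi⟩ := Finsupp.ne_iff.1 hne
  simp only [Finsupp.coe_zero, Pi.zero_apply] at hi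
  have hsplit := Finsupp.single_add_erase i d
  have hdeg : (Finsupp.single i (d i)).degree + (d.erase i).degree = 1 := by
    rw [← map_add, hsplit, hd]
  rw [Finsupp.degree_single] at hdeg
  have hdi : d i = 1 := by omega
  have herase : (d.erase i).degree = 0 := by omega
  rw [Finsupp.degree_eq_zero_iff] at herase
  refine ⟨i, ?_⟩
  rw [← hsplit, herase, hdi, add_zero]

/-- A monomial exponent of degree `2` is `X_a X_b` (possibly `a = b`). [folklore] -/
private theorem exists_eq_single_add_single {d : Fin m →₀ ℕ} (hd : d.degree = 2) :
    ∃ a b, d = Finsupp.single a 1 + Finsupp.single b 1 := by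
  classical
  have hne : d ≠ 0 := by
    rintro rfl
    simp at hd
  obtain ⟨a, ha⟩ := Finsupp.ne_iff.1 hne
  simp only [Finsupp.coe_zero, Pi.zero_apply] at ha
  have hsplit := Finsupp.single_add_erase a d
  have hdeg : (Finsupp.single a (d a)).degree + (d.erase a).degree = 2 := by
    rw [← map_add, hsplit, hd]
  rw [Finsupp.degree_single] at hdeg
  by_cases h2 : d a = 2
  · have herase : (d.erase a).degree = 0 := by omega
    rw [Finsupp.degree_eq_zero_iff] at herase
    refine ⟨a, a, ?_⟩
    rw [← Finsupp.single_add, ← hsplit, herase, add_zero, h2]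
  · have h1 : d a = 1 := by omega
    have herase : (d.erase a).degree = 1 := by omega
    obtain ⟨b, hb⟩ := exists_eq_single_of_degree_eq_one' herase
    refine ⟨a, b, ?_⟩
    rw [← hsplit, hb, h1]

/-- `X_i X_j = X_a X_b` iff `{i, j} = {a, b}`. [folklore] -/
private theorem single_add_single_eq_iff {i j a b : Fin m} :
    Finsupp.single i 1 + Finsupp.single j 1 = Finsupp.single a 1 + Finsupp.single b 1 ↔
      (i = a ∧ j = b) ∨ (i = b ∧ j = a) := by
  rw [Finsupp.single_add_single_eq_single_add_single one_ne_zero one_ne_zero]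
  constructor
  · rintro (h | ⟨-, h⟩ | ⟨h, -⟩)
    · exact Or.inl h
    · exact Or.inr h
    · exact absurd h (by norm_num)
  · rintro (h | h)
    · exact Or.inl h
    · exact Or.inr (Or.inl ⟨rfl, h⟩)

/-- `X_i X_j` as a monomial. [folklore] -/
private theorem X_mul_X_eq (i j : Fin m) :
    (X i * X j : MvPolynomial (Fin m) ℂ) = monomial (Finsupp.single i 1 + Finsupp.single j 1) 1 := by
  rw [show (X i : MvPolynomial (Fin m) ℂ) = monomial (Finsupp.single i 1) 1 by
      rw [← X_pow_eq_monomial, pow_one],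
    show (X j : MvPolynomial (Fin m) ℂ) = monomial (Finsupp.single j 1) 1 by
      rw [← X_pow_eq_monomial, pow_one],
    monomial_mul, mul_one]

/-- A double Kronecker sum. [folklore] -/
private theorem sum_sum_ite_and (S : Matrix (Fin m) (Fin m) ℂ) (a b : Fin m) :
    (∑ i, ∑ j, if i = a ∧ j = b then S i j else 0) = S a b := by
  have h : ∀ i, (∑ j, if i = a ∧ j = b then S i j else 0) = if i = a then S i b else 0 := by
    intro i
    by_cases hi : i = a
    · subst hi
      simp
    · simp [hi]
  simp_rw [h]
  simp

/-- The quadratic form `xᵀ S x = ∑_{i,j} S_{ij} X_i X_j` of a square matrix. [folklore] -/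
private def quadPoly (S : Matrix (Fin m) (Fin m) ℂ) : MvPolynomial (Fin m) ℂ :=
  ∑ i, ∑ j, S i j • (X i * X j)

/-- The Hessian (twice the Gram matrix) of a quadratic form: `H_{ii} = 2 c_{ii}`, `H_{ij} = c_{ij}`
for `f = ∑_{i ≤ j} c_{ij} X_i X_j`. [folklore] -/
private def quadHessian (f : MvPolynomial (Fin m) ℂ) : Matrix (Fin m) (Fin m) ℂ :=
  fun i j => if i = j then 2 * coeff (Finsupp.single i 2) f
    else coeff (Finsupp.single i 1 + Finsupp.single j 1) f

/-- Diagonal entries of the Hessian. [folklore] -/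
private theorem quadHessian_apply_same (f : MvPolynomial (Fin m) ℂ) (i : Fin m) :
    quadHessian f i i = 2 * coeff (Finsupp.single i 2) f :=
  if_pos rfl

/-- Off-diagonal entries of the Hessian. [folklore] -/
private theorem quadHessian_apply_ne (f : MvPolynomial (Fin m) ℂ) {i j : Fin m} (h : i ≠ j) :
    quadHessian f i j = coeff (Finsupp.single i 1 + Finsupp.single j 1) f :=
  if_neg h

/-- The Hessian is symmetric. [folklore] -/
private theorem quadHessian_transpose (f : MvPolynomial (Fin m) ℂ) :
    (quadHessian f)ᵀ = quadHessian f := by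
  ext i j
  rw [transpose_apply]
  by_cases h : i = j
  · subst h
    rfl
  · rw [quadHessian_apply_ne f h, quadHessian_apply_ne f (Ne.symm h), add_comm]

/-- Evaluating `quadPoly`: `(xᵀ S x)(y) = y ⬝ (S y)`. [folklore] -/
private theorem eval_quadPoly (S : Matrix (Fin m) (Fin m) ℂ) (y : Fin m → ℂ) :
    eval y (quadPoly S) = y ⬝ᵥ (S *ᵥ y) := by
  simp only [quadPoly, map_sum, smul_eval, map_mul, eval_X, dotProduct, mulVec, Finset.mul_sum]
  exact Finset.sum_congr rfl fun i _ => Finset.sum_congr rfl fun j _ => by ring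

/-- Evaluating a linear substitution: `(M · f)(x) = f(Mᵀ x)` (private copy, as in
`CharacterizedByStabilizerSL.lean`). [folklore] -/
private theorem eval_linSubst' (M : Matrix (Fin m) (Fin m) ℂ) (x : Fin m → ℂ)
    (f : MvPolynomial (Fin m) ℂ) : eval x (linSubst (Fin m) ℂ M f) = eval (Mᵀ *ᵥ x) f := by
  induction f using MvPolynomial.induction_on with
  | C a => rw [linSubst_C, eval_C, eval_C]
  | add p q hp hq => rw [map_add, map_add, map_add, hp, hq]
  | mul_X p i hp =>
    rw [map_mul, map_mul, map_mul, hp, linSubst_X, eval_X]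
    congr 1
    simp [mulVec, dotProduct, smul_eval]

/-- **Substitutions act on Gram matrices by congruence**: `A · (xᵀ S x) = xᵀ (A S Aᵀ) x`.
[folklore] -/
private theorem linSubst_quadPoly (A S : Matrix (Fin m) (Fin m) ℂ) :
    linSubst (Fin m) ℂ A (quadPoly S) = quadPoly (A * S * Aᵀ) := by
  apply MvPolynomial.funext
  intro x
  rw [eval_linSubst', eval_quadPoly, eval_quadPoly, mulVec_transpose, ← mulVec_mulVec,
    ← mulVec_mulVec, mulVec_transpose, dotProduct_mulVec x A]

/-- The coefficients of `quadPoly S`. [folklore] -/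
private theorem coeff_quadPoly (S : Matrix (Fin m) (Fin m) ℂ) (d : Fin m →₀ ℕ) :
    coeff d (quadPoly S) =
      ∑ i, ∑ j, if Finsupp.single i 1 + Finsupp.single j 1 = d then S i j else 0 := by
  simp only [quadPoly, coeff_sum, coeff_smul, X_mul_X_eq, coeff_monomial, smul_eq_mul, mul_ite,
    mul_one, mul_zero]

/-- The coefficient of `X_a X_b`, `a ≠ b`, in `xᵀ S x` is `S_{ab} + S_{ba}`. [folklore] -/
private theorem coeff_quadPoly_offDiag (S : Matrix (Fin m) (Fin m) ℂ) {a b : Fin m} (hab : a ≠ b) :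
    coeff (Finsupp.single a 1 + Finsupp.single b 1) (quadPoly S) = S a b + S b a := by
  rw [coeff_quadPoly]
  have h : ∀ i j : Fin m,
      (if Finsupp.single i 1 + Finsupp.single j 1 = Finsupp.single a 1 + Finsupp.single b 1
        then S i j else 0) =
        (if i = a ∧ j = b then S i j else 0) + (if i = b ∧ j = a then S i j else 0) := by
    intro i j
    by_cases h1 : i = a ∧ j = b
    · have h2 : ¬(i = b ∧ j = a) := fun h2 => hab (h1.1.symm.trans h2.1)
      rw [if_pos (single_add_single_eq_iff.mpr (Or.inl h1)), if_pos h1, if_neg h2, add_zero]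
    · by_cases h2 : i = b ∧ j = a
      · rw [if_pos (single_add_single_eq_iff.mpr (Or.inr h2)), if_neg h1, if_pos h2, zero_add]
      · rw [if_neg (fun h => (single_add_single_eq_iff.mp h).elim h1 h2), if_neg h1, if_neg h2,
          add_zero]
  simp_rw [h, Finset.sum_add_distrib, sum_sum_ite_and]

/-- The coefficient of `X_a²` in `xᵀ S x` is `S_{aa}`. [folklore] -/
private theorem coeff_quadPoly_diag (S : Matrix (Fin m) (Fin m) ℂ) (a : Fin m) :
    coeff (Finsupp.single a 2) (quadPoly S) = S a a := by
  rw [coeff_quadPoly]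
  have key : ∀ i j : Fin m,
      Finsupp.single i 1 + Finsupp.single j 1 = Finsupp.single a 2 ↔ i = a ∧ j = a := by
    intro i j
    rw [show (Finsupp.single a 2 : Fin m →₀ ℕ) = Finsupp.single a 1 + Finsupp.single a 1 by
      rw [← Finsupp.single_add], single_add_single_eq_iff, or_self_iff]
  have h : ∀ i j : Fin m,
      (if Finsupp.single i 1 + Finsupp.single j 1 = Finsupp.single a 2 then S i j else 0) =
        if i = a ∧ j = a then S i j else 0 := by
    intro i j
    by_cases h1 : i = a ∧ j = a
    · rw [if_pos ((key i j).mpr h1), if_pos h1]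
    · rw [if_neg (fun h => h1 ((key i j).mp h)), if_neg h1]
  simp_rw [h, sum_sum_ite_and]

/-- **The Hessian of `xᵀ S x` is `S + Sᵀ`.** [folklore] -/
private theorem quadHessian_quadPoly (S : Matrix (Fin m) (Fin m) ℂ) :
    quadHessian (quadPoly S) = S + Sᵀ := by
  ext i j
  rw [Matrix.add_apply, transpose_apply]
  by_cases h : i = j
  · subst h
    rw [quadHessian_apply_same, coeff_quadPoly_diag, two_mul]
  · rw [quadHessian_apply_ne _ h, coeff_quadPoly_offDiag S h]

/-- **A quadratic form is half its Hessian form**: `xᵀ (quadHessian f) x = 2 f` for `f ∈ Sym²`.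
[folklore] -/
private theorem quadPoly_quadHessian {f : MvPolynomial (Fin m) ℂ} (hf : f.IsHomogeneous 2) :
    quadPoly (quadHessian f) = (2 : ℂ) • f := by
  ext d
  rw [coeff_smul, smul_eq_mul]
  by_cases hd : d.degree = 2
  · obtain ⟨a, b, rfl⟩ := exists_eq_single_add_single hd
    by_cases hab : a = b
    · subst hab
      rw [← Finsupp.single_add, coeff_quadPoly_diag, quadHessian_apply_same]
    · rw [coeff_quadPoly_offDiag _ hab, quadHessian_apply_ne f hab,
        quadHessian_apply_ne f (Ne.symm hab), add_comm (Finsupp.single b 1), ← two_mul]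
  · rw [hf.coeff_eq_zero hd, mul_zero, coeff_quadPoly]
    refine Finset.sum_eq_zero fun i _ => Finset.sum_eq_zero fun j _ => if_neg fun h => hd ?_
    rw [← h, map_add, Finsupp.degree_single, Finsupp.degree_single]

/-- `quadPoly` is linear in the matrix: `xᵀ (c S) x = c · xᵀ S x`. [folklore] -/
private theorem quadPoly_smul (c : ℂ) (S : Matrix (Fin m) (Fin m) ℂ) :
    quadPoly (c • S) = c • quadPoly S := by
  simp only [quadPoly, Matrix.smul_apply, smul_eq_mul, Finset.smul_sum, smul_smul]

/-- The identity matrix gives the Fermat quadric: `xᵀ x = X_1² + ⋯ + X_m²`. [folklore] -/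
private theorem quadPoly_one : quadPoly (1 : Matrix (Fin m) (Fin m) ℂ) = ∑ i : Fin m, X i ^ 2 := by
  simp only [quadPoly, Matrix.one_apply, ite_smul, one_smul, zero_smul, Finset.sum_ite_eq,
    Finset.mem_univ, if_true, sq]

/-! ### The discriminant as a polynomial in the coefficients -/

/-- The Hessian with polynomial entries: the matrix of coordinate functions on `Sym²` whose value at
`formCoeff 2 f` is `quadHessian f`. [folklore] -/
private def quadHessianPoly (m : ℕ) : Matrix (Fin m) (Fin m) (MvPolynomial (DegIdx (Fin m) 2) ℂ) :=
  fun i j => if i = j then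
      2 * X ⟨Finsupp.single i 2, mem_degMonomials_iff.mpr (Finsupp.degree_single i 2)⟩
    else X ⟨Finsupp.single i 1 + Finsupp.single j 1, mem_degMonomials_iff.mpr (by
      rw [map_add, Finsupp.degree_single, Finsupp.degree_single])⟩

/-- The discriminant `det (quadHessianPoly m)` evaluates at a form to `det (quadHessian f)`. [folklore] -/
private theorem aeval_det_quadHessianPoly (f : MvPolynomial (Fin m) ℂ) :
    aeval (formCoeff 2 f) (quadHessianPoly m).det = (quadHessian f).det := by
  rw [AlgHom.map_det]
  congr 1
  ext i j
  simp only [AlgHom.mapMatrix_apply, map_apply, quadHessianPoly, quadHessian]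
  split_ifs with h
  · rw [map_mul, aeval_X, formCoeff_apply, map_ofNat]
  · rw [aeval_X, formCoeff_apply]

/-- The Hessian of `X_1² + ⋯ + X_m²` is `2·1`. [folklore] -/
private theorem quadHessian_sumSq :
    quadHessian (∑ i : Fin m, X i ^ 2 : MvPolynomial (Fin m) ℂ) = (2 : ℂ) • (1 : Matrix (Fin m) (Fin m) ℂ) := by
  have hc : ∀ d : Fin m →₀ ℕ, coeff d (∑ i : Fin m, X i ^ 2 : MvPolynomial (Fin m) ℂ) =
      ∑ i : Fin m, if Finsupp.single i 2 = d then 1 else 0 := by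
    intro d
    simp only [coeff_sum, X_pow_eq_monomial, coeff_monomial]
  ext i j
  rw [Matrix.smul_apply, one_apply, smul_eq_mul, mul_ite, mul_one, mul_zero]
  by_cases h : i = j
  · subst h
    rw [if_pos rfl, quadHessian_apply_same, hc, Finset.sum_eq_single i, if_pos rfl, mul_one]
    · intro k _ hk
      exact if_neg fun e => hk (Finsupp.single_left_injective (by norm_num) e)
    · intro hi
      exact absurd (Finset.mem_univ i) hi
  · rw [if_neg h, quadHessian_apply_ne _ h, hc]
    refine Finset.sum_eq_zero fun k _ => if_neg fun e => ?_
    have := congrArg (fun d : Fin m →₀ ℕ => d i) e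
    simp only [Finsupp.single_apply, Finsupp.coe_add, Pi.add_apply, if_neg (Ne.symm h)] at this
    split_ifs at this; omega

/-- The discriminant polynomial is not zero (it is `2^m` at `X_1² + ⋯ + X_m²`). [folklore] -/
private theorem det_quadHessianPoly_ne_zero : (quadHessianPoly m).det ≠ 0 := by
  intro h
  have := aeval_det_quadHessianPoly (∑ i : Fin m, X i ^ 2 : MvPolynomial (Fin m) ℂ)
  rw [h, map_zero, quadHessian_sumSq, det_smul, det_one, mul_one, Fintype.card_fin] at this
  exact pow_ne_zero m two_ne_zero this.symm


/-! ### §3 Nondegenerate symmetric matrices over `ℂ` are congruent to the identity -/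

/-- **A symmetric complex matrix with nonzero determinant is `E Eᵀ` with `det E ≠ 0`** (congruence
to the identity; Mathlib's `QuadraticForm.equivalent_of_isAlgClosed` for the quadratic forms
`x ↦ xᵀ H x` and `x ↦ xᵀ x`, transported to matrices by `QuadraticForm.toMatrix'_comp`). This is
the matrix form of BI 2017's remark "in the exceptional case `D = 2` of quadratic forms, the orbit of
`X_1² + ⋯ + X_m²` is dense in `Sym²ℂ^m`" (every nondegenerate quadric is `GL_m`-equivalent to the
Fermat quadric). [cite: BurgisserIkenmeyer2017, §2.1 (remark after Thm. 2.3, TeX L482–486)] -/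
theorem exists_eq_mul_transpose_of_det_ne_zero {H : Matrix (Fin m) (Fin m) ℂ} (hH : Hᵀ = H)
    (hdet : H.det ≠ 0) : ∃ E : Matrix (Fin m) (Fin m) ℂ, E.det ≠ 0 ∧ H = E * Eᵀ := by
  -- the two quadratic forms and their (symmetric) bilinear forms
  have hsymm : ∀ (S : Matrix (Fin m) (Fin m) ℂ), Sᵀ = S →
      ∀ x y : Fin m → ℂ, Matrix.toLinearMap₂' ℂ S x y = Matrix.toLinearMap₂' ℂ S y x := by
    intro S hS x y
    rw [Matrix.toLinearMap₂'_apply', Matrix.toLinearMap₂'_apply', dotProduct_mulVec,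
      ← mulVec_transpose, hS, dotProduct_comm]
  have hassoc : ∀ (S : Matrix (Fin m) (Fin m) ℂ), Sᵀ = S →
      QuadraticMap.associated (S.toQuadraticForm') = Matrix.toLinearMap₂' ℂ S := fun S hS =>
    QuadraticMap.associated_left_inverse (S := ℂ) (hsymm S hS)
  have hmat : ∀ (S : Matrix (Fin m) (Fin m) ℂ), Sᵀ = S → (S.toQuadraticForm').toMatrix' = S := by
    intro S hS
    rw [QuadraticForm.toMatrix', hassoc S hS, LinearMap.toMatrix'_toLinearMap₂']
  have hsep : ∀ (S : Matrix (Fin m) (Fin m) ℂ), Sᵀ = S → S.det ≠ 0 →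
      (QuadraticMap.associated (S.toQuadraticForm')).SeparatingLeft := by
    intro S hS hS0
    rw [hassoc S hS]
    exact LinearMap.separatingLeft_toLinearMap₂'_of_det_ne_zero' hS0
  have h1T : (1 : Matrix (Fin m) (Fin m) ℂ)ᵀ = 1 := transpose_one
  obtain ⟨e⟩ := QuadraticForm.equivalent_of_isAlgClosed (H.toQuadraticForm')
    ((1 : Matrix (Fin m) (Fin m) ℂ).toQuadraticForm') (hsep H hH hdet)
    (hsep 1 h1T (by rw [det_one]; exact one_ne_zero))
  -- `xᵀ H x = (e x)ᵀ (e x)`, i.e. `H = Fᵀ F` for the matrix `F` of `e`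
  set F : Matrix (Fin m) (Fin m) ℂ := LinearMap.toMatrix' (e : (Fin m → ℂ) →ₗ[ℂ] (Fin m → ℂ))
    with hF
  have hcomp : H.toQuadraticForm' =
      ((1 : Matrix (Fin m) (Fin m) ℂ).toQuadraticForm').comp (e : (Fin m → ℂ) →ₗ[ℂ] (Fin m → ℂ)) := by
    ext x
    rw [QuadraticMap.comp_apply]
    exact (e.map_app x).symm
  have hHF : H = Fᵀ * F := by
    have h := congrArg QuadraticForm.toMatrix' hcomp
    rwa [QuadraticForm.toMatrix'_comp, hmat H hH, hmat 1 h1T, Matrix.mul_one] at h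
  refine ⟨Fᵀ, ?_, by rw [transpose_transpose]; exact hHF⟩
  rw [det_transpose]
  intro hF0
  apply hdet
  rw [hHF, det_mul, det_transpose, hF0, mul_zero]

/-! ### §4 Nondegenerate quadratic forms are polystable -/

/-- **Every nondegenerate quadratic form is polystable** (the content of BI 2017 Prop. 2.10 at
`D = 2`): if `f ∈ Sym² ℂ^m` has Hessian discriminant `det H_f ≠ 0`, then the `SL_m`-orbit of `f` is
Zariski closed. Indeed `H_f = E Eᵀ` with `det E ≠ 0`, so `f = ½ xᵀ H_f x = (a E) · (X_1² + ⋯ + X_m²)`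
with `a² = ½`, and `X_1² + ⋯ + X_m²` is polystable (`isPolystable_sum_X_pow`) while polystability is
a property of `GL`-orbits (`IsPolystable.linSubst_of_det_ne_zero`).
[cite: BurgisserIkenmeyer2017, Prop. 2.10 (case D = 2, TeX L638–640)] -/
theorem isPolystable_of_det_quadHessian_ne_zero {f : MvPolynomial (Fin m) ℂ} (hf : f.IsHomogeneous 2)
    (hdet : (quadHessian f).det ≠ 0) : IsPolystable f := by
  obtain ⟨E, hE, hHE⟩ := exists_eq_mul_transpose_of_det_ne_zero (quadHessian_transpose f) hdet
  obtain ⟨a, ha⟩ := IsAlgClosed.exists_eq_mul_self ((2 : ℂ)⁻¹)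
  have ha0 : a ≠ 0 := by
    rintro rfl
    rw [mul_zero, inv_eq_zero] at ha
    exact two_ne_zero ha
  have hfE : f = linSubst (Fin m) ℂ (a • E) (∑ i : Fin m, X i ^ 2) := by
    rw [← quadPoly_one, linSubst_quadPoly, Matrix.mul_one, transpose_smul, smul_mul_smul_comm, ← hHE,
      quadPoly_smul, quadPoly_quadHessian hf, smul_smul, ← ha, inv_mul_cancel₀ two_ne_zero, one_smul]
  rw [hfE]
  refine (isPolystable_sum_X_pow m one_lt_two).linSubst_of_det_ne_zero ?_
  rw [det_smul, Fintype.card_fin]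
  exact mul_ne_zero (pow_ne_zero m ha0) hE

end Quadratic

/-! ### §5 The `D = 2` slice of Prop. 2.10, and the residual -/

/-- **BI 2017, Prop. 2.10 at `D = 2`: almost all quadratic forms are polystable.** For every `m`,
`IsZariskiGeneric 2 IsPolystable` on `Sym² ℂ^m`: the discriminant `det (quadHessianPoly m)` is a
nonzero polynomial in the degree-`2` coefficients (`2^m` at `X_1² + ⋯ + X_m²`), and every form off
its zero set is polystable (`isPolystable_of_det_quadHessian_ne_zero`). This is the printed
parenthesis "(In the exceptional case `D = 2` of quadratic forms, all `SL_m`-orbits [of nondegenerate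
forms] in `Sym²ℂ^m` are closed.)"; the `D > 2` body of Prop. 2.10 (Thm. 2.3 + Luna 1973) is NOT
proved here. [cite: BurgisserIkenmeyer2017, Prop. 2.10 (case D = 2, TeX L633–640; held p0007.txt:L60)] -/
theorem BI2017_prop_2_10_two (m : ℕ) :
    IsZariskiGeneric 2 (IsPolystable : MvPolynomial (Fin m) ℂ → Prop) := by
  refine ⟨(quadHessianPoly m).det, det_quadHessianPoly_ne_zero, fun f hf hF => ?_⟩
  rw [aeval_det_quadHessianPoly] at hF
  exact isPolystable_of_det_quadHessian_ne_zero hf hF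

/-- **Bookkeeping of the residual**: the named fact `BI2017_prop_2_10` ("if `D > 1`, almost all
`w ∈ Sym^D ℂ^m` are polystable") follows from its `D > 2` part alone, the case `D = 2` being
`BI2017_prop_2_10_two`. (The `D > 2` part — Thm. 2.3, in the tree as `BI2017_thm_2_3_open_holds`,
plus Luna's criterion [Lun73, Cor. 1] — is not in the tree; this theorem records exactly what is
left.) [cite: BurgisserIkenmeyer2017, Prop. 2.10] -/
theorem BI2017_prop_2_10_of_two_lt
    (h : ∀ (D m : ℕ), 2 < D → IsZariskiGeneric D (IsPolystable : MvPolynomial (Fin m) ℂ → Prop)) :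
    BI2017_prop_2_10 := by
  intro D m hD
  rcases Nat.lt_or_ge 2 D with hD2 | hD2
  · exact h D m hD2
  · obtain rfl : D = 2 := le_antisymm hD2 hD
    exact BI2017_prop_2_10_two m

/-! ### §6 The trivial slices `m ≤ 1` and the exact residual `D ≥ 3`, `m ≥ 2` -/

section TrivialSlices

variable {σ k : Type*} [Fintype σ] [DecidableEq σ] [Field k]

omit [Fintype σ] [DecidableEq σ] in
/-- A point of coefficient space is Zariski closed: the closure of `{x}` is `{x}` (the coordinate
functions `X_d - x_d` cut it out). [cite: BurgisserIkenmeyer2017, Def. 2.7] -/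
theorem zariskiClosure_singleton_coeff (x : (σ →₀ ℕ) → k) :
    zariskiClosure ({x} : Set ((σ →₀ ℕ) → k)) = {x} := by
  refine Set.Subset.antisymm (fun y hy => ?_) (subset_zariskiClosure _)
  rw [Set.mem_singleton_iff]
  funext d
  have h := (mem_zariskiClosure_iff.mp hy) (X d - C (x d)) fun z hz => by
    rw [Set.mem_singleton_iff.mp hz, map_sub, aeval_X, aeval_C, Algebra.algebraMap_self_apply, sub_self]
  rwa [map_sub, aeval_X, aeval_C, Algebra.algebraMap_self_apply, sub_eq_zero] at h

/-- When there is at most one variable, `SL σ k` is trivial and every `SL`-orbit is a point; in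
particular EVERY polynomial is polystable (the cases `m = 0, 1` of `Sym^D ℂ^m`).
[cite: BurgisserIkenmeyer2017, Def. 2.7] -/
theorem isPolystable_of_card_le_one (hσ : Fintype.card σ ≤ 1) (f : MvPolynomial σ k) :
    IsPolystable f := by
  haveI : Subsingleton σ := Fintype.card_le_one_iff_subsingleton.mp hσ
  have hSL : ∀ s : Matrix.SpecialLinearGroup σ k, (s : Matrix σ σ k) = 1 := by
    intro s
    ext i j
    rw [Subsingleton.elim j i, Matrix.one_apply_eq,
      ← Matrix.det_eq_elem_of_subsingleton (s : Matrix σ σ k) i]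
    exact s.prop
  have horbit : slOrbit σ k f = {f} := by
    ext p
    rw [mem_slOrbit_iff, Set.mem_singleton_iff]
    constructor
    · rintro ⟨s, rfl⟩
      rw [hSL s, linSubst_one, AlgHom.id_apply]
    · rintro rfl
      exact (mem_slOrbit_iff p p).mp (mem_slOrbit_self p)
  intro y hy
  rw [horbit, Set.image_singleton, zariskiClosure_singleton_coeff] at hy
  rw [horbit, Set.image_singleton]
  exact hy

end TrivialSlices

/-- **The slices `m ≤ 1` of Prop. 2.10** (every degree `D`): with at most one variable every form
is polystable, so `IsZariskiGeneric D IsPolystable` holds with the constant test polynomial `1`.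
[cite: BurgisserIkenmeyer2017, Prop. 2.10] -/
theorem isZariskiGeneric_isPolystable_of_le_one {m : ℕ} (hm : m ≤ 1) (D : ℕ) :
    IsZariskiGeneric D (IsPolystable : MvPolynomial (Fin m) ℂ → Prop) :=
  ⟨1, one_ne_zero, fun f _ _ => isPolystable_of_card_le_one (by rwa [Fintype.card_fin]) f⟩

/-- **Exact residual of Prop. 2.10 after this file**: the named fact `BI2017_prop_2_10` follows from
its instances with `D ≥ 3` and `m ≥ 2` — the range of the printed proof (Thm. 2.3 + Luna 1973),
which is NOT proved here; `D = 2` is `BI2017_prop_2_10_two`, `m ≤ 1` is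
`isZariskiGeneric_isPolystable_of_le_one`. [cite: BurgisserIkenmeyer2017, Prop. 2.10] -/
theorem BI2017_prop_2_10_of_main
    (h : ∀ (D m : ℕ), 3 ≤ D → 2 ≤ m →
      IsZariskiGeneric D (IsPolystable : MvPolynomial (Fin m) ℂ → Prop)) :
    BI2017_prop_2_10 := by
  refine BI2017_prop_2_10_of_two_lt fun D m hD => ?_
  rcases Nat.lt_or_ge m 2 with hm | hm
  · exact isZariskiGeneric_isPolystable_of_le_one (by omega) D
  · exact h D m hD hm

/-! ### §7 Scalars: `IsPolystable (c • f) ↔ IsPolystable f` -/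

section Scalars

variable {σ k : Type*} [Fintype σ] [DecidableEq σ] [Field k]

/-- The `SL`-orbit of a scalar multiple: `SL · (c f) = c · (SL · f)` (substitutions are linear).
[cite: BurgisserIkenmeyer2017, Def. 2.7] -/
theorem slOrbit_smul (c : k) (f : MvPolynomial σ k) :
    slOrbit σ k (c • f) = (c • ·) '' slOrbit σ k f := by
  ext p
  constructor
  · rintro ⟨s, rfl⟩
    exact ⟨linSubst σ k (s : Matrix σ σ k) f, ⟨s, rfl⟩, (map_smul _ c f).symm⟩
  · rintro ⟨q, ⟨s, rfl⟩, rfl⟩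
    exact ⟨s, (map_smul (linSubst σ k (s : Matrix σ σ k)) c f).symm⟩

omit [Fintype σ] [DecidableEq σ] in
/-- Coefficient vectors are linear in the polynomial. [cite: BurgisserIkenmeyer2017, Def. 2.7] -/
theorem coeffVec_smul (c : k) (f : MvPolynomial σ k) : coeffVec (c • f) = c • coeffVec f := by
  funext d
  rw [coeffVec_apply, Pi.smul_apply, coeffVec_apply, coeff_smul]

omit [Fintype σ] [DecidableEq σ] in
/-- Polynomial functions pull back to polynomial functions under scaling of the coefficient space:
`F (c • y) = F_c (y)` with `F_c = F(c X_d)`. [cite: BurgisserIkenmeyer2017, Def. 2.7] -/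
theorem aeval_smul_eq_aeval_aeval (c : k) (y : (σ →₀ ℕ) → k) (F : MvPolynomial (σ →₀ ℕ) k) :
    aeval (c • y) F = aeval y (aeval (fun d : σ →₀ ℕ => C c * X d) F) := by
  have hcomp : (aeval y).comp (aeval fun d : σ →₀ ℕ => (C c * X d : MvPolynomial (σ →₀ ℕ) k)) =
      aeval (c • y) := by
    rw [MvPolynomial.comp_aeval]
    refine congrArg _ (funext fun d => ?_)
    simp only [map_mul, aeval_C, aeval_X, Pi.smul_apply, smul_eq_mul, Algebra.algebraMap_self_apply]
  rw [← hcomp, AlgHom.comp_apply]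

/-- **Polystability is invariant under non-zero scalars**: `c • f` is polystable when `f` is
(`c ≠ 0`; ANY field, ANY polynomial — scaling is a polynomial automorphism of coefficient space
commuting with the `SL`-action). General form of the tree's `IsPolystable.smul`
(`MonomialPolystability.lean`: over `ℂ`, `f` homogeneous of positive degree, via a `D`-th root and
`IsPolystable.glAct`); this version needs no roots. [cite: BurgisserIkenmeyer2017, Def. 2.7] -/
theorem IsPolystable.const_smul {f : MvPolynomial σ k} (hf : IsPolystable f) {c : k} (hc : c ≠ 0) :
    IsPolystable (c • f) := by
  intro y hy
  -- `c⁻¹ • y` is a closure point of `coeffVec '' SL·f`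
  have h1 : c⁻¹ • y ∈ zariskiClosure (coeffVec '' slOrbit σ k f) := by
    rw [mem_zariskiClosure_iff]
    intro F hF
    rw [aeval_smul_eq_aeval_aeval]
    apply mem_zariskiClosure_iff.mp hy
    rintro _ ⟨q, hq, rfl⟩
    rw [slOrbit_smul] at hq
    obtain ⟨q₀, hq₀, rfl⟩ := hq
    rw [← aeval_smul_eq_aeval_aeval, coeffVec_smul, smul_smul, inv_mul_cancel₀ hc, one_smul]
    exact hF _ ⟨q₀, hq₀, rfl⟩
  obtain ⟨q₀, hq₀, hq₀y⟩ := hf h1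
  refine ⟨c • q₀, ?_, ?_⟩
  · rw [slOrbit_smul]
    exact ⟨q₀, hq₀, rfl⟩
  · rw [coeffVec_smul, hq₀y, smul_smul, mul_inv_cancel₀ hc, one_smul]

/-- `IsPolystable (c • f) ↔ IsPolystable f` for `c ≠ 0`. [cite: BurgisserIkenmeyer2017, Def. 2.7] -/
theorem isPolystable_smul_iff {f : MvPolynomial σ k} {c : k} (hc : c ≠ 0) :
    IsPolystable (c • f) ↔ IsPolystable f := by
  refine ⟨fun h => ?_, fun h => h.const_smul hc⟩
  have h' := h.const_smul (inv_ne_zero hc)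
  rwa [smul_smul, inv_mul_cancel₀ hc, one_smul] at h'

end Scalars

/-! ### §8 Generic properties are satisfied by some form -/

section GenericNonempty

variable {σ k : Type*} [Fintype σ] [DecidableEq σ] [Field k]

/-- Every coefficient vector on the degree-`D` monomials is the coefficient vector of a form of
degree `D` (private copy of `exists_isHomogeneous_formCoeff_eq` of `FewLetterEquations.lean`, to keep
the imports of this file small). [folklore] -/
private theorem exists_isHomogeneous_formCoeff_eq' (D : ℕ) (v : DegIdx σ D → k) :
    ∃ f : MvPolynomial σ k, f.IsHomogeneous D ∧ formCoeff D f = v := by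
  classical
  refine ⟨∑ d : DegIdx σ D, v d • monomial d.1 (1 : k), ?_, ?_⟩
  · refine IsHomogeneous.sum _ _ _ fun d _ => ?_
    rw [smul_monomial, smul_eq_mul, mul_one]
    exact isHomogeneous_monomial _ (mem_degMonomials_iff.mp d.2)
  · funext d
    rw [formCoeff_apply, coeff_sum]
    simp only [coeff_smul, coeff_monomial, smul_eq_mul, mul_ite, mul_one, mul_zero]
    rw [Finset.sum_eq_single d (fun e _ hne => if_neg fun h => hne (Subtype.ext h))
      (fun h => absurd (Finset.mem_univ d) h), if_pos rfl]

/-- **A Zariski-generic property of forms holds for SOME form** (over an infinite field a non-zero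
polynomial has a non-zero value): consistency guard for `IsZariskiGeneric` statements — in
particular two generic properties are simultaneously satisfiable (`IsZariskiGeneric.and`) and
`IsZariskiGeneric D (fun _ => False)` is impossible (`not_isZariskiGeneric_false`).
[cite: BurgisserIkenmeyer2017, §2.1 ("almost all")] -/
theorem IsZariskiGeneric.exists_form [Infinite k] {D : ℕ} {P : MvPolynomial σ k → Prop}
    (h : IsZariskiGeneric D P) : ∃ f : MvPolynomial σ k, f.IsHomogeneous D ∧ P f := by
  obtain ⟨F, hF0, hF⟩ := h
  have hv : ∃ v : DegIdx σ D → k, aeval v F ≠ 0 := by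
    by_contra hall
    push Not at hall
    exact hF0 (MvPolynomial.funext fun v => by rw [map_zero, ← coe_aeval_eq_eval]; exact hall v)
  obtain ⟨v, hv⟩ := hv
  obtain ⟨f, hf, hfv⟩ := exists_isHomogeneous_formCoeff_eq' D v
  exact ⟨f, hf, hF f hf (by rwa [hfv])⟩

/-- No property that fails for every form is Zariski-generic. [cite: BurgisserIkenmeyer2017, §2.1 ("almost all")] -/
theorem not_isZariskiGeneric_false [Infinite k] (D : ℕ) :
    ¬ IsZariskiGeneric D (fun _ : MvPolynomial σ k => False) := by
  intro h
  obtain ⟨_, _, hfalse⟩ := IsZariskiGeneric.exists_form h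
  exact hfalse

end GenericNonempty

/-! ### §9 Over `ℂ`: polystable iff the `SL`-orbit is closed in the Euclidean topology of `Sym^m` -/

section Euclidean

variable {σ : Type*} [Fintype σ] [DecidableEq σ]

omit [Fintype σ] [DecidableEq σ] in
/-- Substituting "restriction to the degree-`m` coordinates, zero elsewhere" into a polynomial
function on the big coefficient space. [cite: BurgisserIkenmeyer2017, Def. 2.7] -/
private theorem aeval_dite_eq_aeval_restrict {m : ℕ} (w : {d : σ →₀ ℕ // d.degree = m} → ℂ)
    (P : MvPolynomial (σ →₀ ℕ) ℂ) :
    aeval (fun d : σ →₀ ℕ => if h : d.degree = m then w ⟨d, h⟩ else 0) P =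
      aeval w (aeval (fun d : σ →₀ ℕ =>
        if h : d.degree = m then (X ⟨d, h⟩ : MvPolynomial {d : σ →₀ ℕ // d.degree = m} ℂ) else 0) P) := by
  have hcomp : (aeval w).comp (aeval fun d : σ →₀ ℕ =>
      if h : d.degree = m then (X ⟨d, h⟩ : MvPolynomial {d : σ →₀ ℕ // d.degree = m} ℂ) else 0) =
      aeval (fun d : σ →₀ ℕ => if h : d.degree = m then w ⟨d, h⟩ else 0) := by
    rw [MvPolynomial.comp_aeval]
    refine congrArg _ (funext fun d => ?_)
    split_ifs with h
    · rw [aeval_X]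
    · rw [map_zero]
  rw [← hcomp, AlgHom.comp_apply]

/-- **Polystable ⇒ the image of the `SL`-orbit in `Sym^m` is closed for the Euclidean topology**
(converse of the tree's bridge `isPolystable_of_isClosed_image_slOrbit`): a classical limit point
`z` of the degree-`m` coefficient vectors of `SL·f`, extended by zero, is a Zariski-closure point of
`coeffVec '' SL·f` (every polynomial vanishing on the orbit, restricted to the degree-`m` coordinates,
is continuous and vanishes on the closure), hence an orbit point.
[cite: BurgisserIkenmeyer2017, Def. 2.7] -/
theorem IsPolystable.isClosed_image_slOrbit {f : MvPolynomial σ ℂ} {m : ℕ} (hf : f.IsHomogeneous m)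
    (hps : IsPolystable f) :
    IsClosed ((fun g (d : {d : σ →₀ ℕ // d.degree = m}) => coeffVec g d.1) '' slOrbit σ ℂ f) := by
  classical
  refine isClosed_of_closure_subset fun z hz => ?_
  -- extend `z` by zero off degree `m`
  set y : (σ →₀ ℕ) → ℂ := fun d => if h : d.degree = m then z ⟨d, h⟩ else 0 with hy
  have hymem : y ∈ zariskiClosure (coeffVec '' slOrbit σ ℂ f) := by
    rw [mem_zariskiClosure_iff]
    intro P hP
    rw [hy, aeval_dite_eq_aeval_restrict]
    set Q := aeval (fun d : σ →₀ ℕ =>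
      if h : d.degree = m then (X ⟨d, h⟩ : MvPolynomial {d : σ →₀ ℕ // d.degree = m} ℂ) else 0) P
      with hQ
    -- `aeval · Q` is continuous and vanishes on the image of the orbit
    have hzero : ∀ w ∈ (fun g (d : {d : σ →₀ ℕ // d.degree = m}) => coeffVec g d.1) '' slOrbit σ ℂ f,
        aeval w Q = 0 := by
      rintro _ ⟨g, hg, rfl⟩
      have hgm : g.IsHomogeneous m := by
        obtain ⟨s, rfl⟩ := hg
        exact linSubst_isHomogeneous _ hf
      have hext : (fun d : σ →₀ ℕ => if h : d.degree = m then
          (fun d' : {d : σ →₀ ℕ // d.degree = m} => coeffVec g d'.1) ⟨d, h⟩ else 0) = coeffVec g := by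
        funext d
        split_ifs with h
        · rfl
        · rw [coeffVec_apply, hgm.coeff_eq_zero h]
      rw [hQ, ← aeval_dite_eq_aeval_restrict, hext]
      exact hP _ ⟨g, hg, rfl⟩
    have hcont : Continuous fun w : {d : σ →₀ ℕ // d.degree = m} → ℂ => aeval w Q := by
      have h := MvPolynomial.continuous_eval Q
      refine h.congr fun w => ?_
      rfl
    have hclosed : IsClosed {w : {d : σ →₀ ℕ // d.degree = m} → ℂ | aeval w Q = 0} :=
      isClosed_eq hcont continuous_const
    exact (hclosed.closure_subset_iff.mpr hzero) hz
  obtain ⟨q, hq, hqy⟩ := hps hymem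
  refine ⟨q, hq, funext fun d => ?_⟩
  have := congr_fun hqy d.1
  rw [hy] at this
  simp only [d.2, dif_pos] at this
  exact this

/-- **Over `ℂ`, a form is polystable (Zariski-closed `SL`-orbit) iff the image of its `SL`-orbit in
`Sym^m` is closed in the Euclidean topology** — the dictionary between the tree's `IsPolystable`
and BI's "the `SL_m`-orbit of `w` is closed" (Def. 2.7) in the analytic sense.
[cite: BurgisserIkenmeyer2017, Def. 2.7] -/
theorem isPolystable_iff_isClosed_image_slOrbit {f : MvPolynomial σ ℂ} {m : ℕ} (hf : f.IsHomogeneous m) :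
    IsPolystable f ↔
      IsClosed ((fun g (d : {d : σ →₀ ℕ // d.degree = m}) => coeffVec g d.1) '' slOrbit σ ℂ f) :=
  ⟨fun h => h.isClosed_image_slOrbit hf, isPolystable_of_isClosed_image_slOrbit hf⟩

end Euclidean

end Literature.Computability.AlgebraicComplexity

end
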